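import Mathlib.AlgebraicGeometry.ProjectiveSpectrum.Functor
import Mathlib.AlgebraicGeometry.ProjectiveSpectrum.Proper
import Mathlib.AlgebraicGeometry.Morphisms.ClosedImmersion
import Mathlib.AlgebraicGeometry.Morphisms.Proper
import Mathlib.RingTheory.MvPolynomial.Homogeneous
import Mathlib.RingTheory.TensorProduct.MvPolynomial
import Mathlib.RingTheory.Localization.BaseChange
import Mathlib.RingTheory.Flat.Basic
import Mathlib.Algebra.Category.Ring.Constructions
import Literature.AlgebraicGeometry.Motives.BaseChangeProofs
import HarnessLib

/-!
# Projective space over a ring: base change along a flat algebra, and properness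

`Literature.AlgebraicGeometry.Motives.BaseChangeProofs` proves that projective space commutes
with base change along an extension of *fields* `k → L`
(`Literature.AlgebraicGeometry.Motives.ProjBaseChange.isPullback_projMap`, following Liu, *Algebraic Geometry and Arithmetic
Curves*, Prop. 3.1.9 and Example 3.1.10). The spreading-out theorem
(`Literature.AlgebraicGeometry.Motives.GoodReductionProofs`) needs the same statement for the
inclusion `𝓞_K → K` of a Dedekind domain into its fraction field, i.e. for an algebra of
commutative rings `k → L`; the proof of `BaseChangeProofs` goes through verbatim as soon as `L` is
*flat* over `k` (flatness is used once, to see that `k[xᵢ]⁰_(s) ⊗ₖ L → k[xᵢ]_s ⊗ₖ L` is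
injective). This file records that generalisation (namespace `Literature.ProjBaseChangeRing`, same
names as in `Literature.ProjBaseChange`), together with the properness of `ℙ(ι)_R → Spec R` over any
commutative ring `R` (Mathlib proves `Proj 𝒜 → Spec 𝒜₀` proper by the valuative criterion; we
compose with the isomorphism `Spec R[xᵢ]₀ ≅ Spec R`, exactly as
`Literature.AlgebraicGeometry.Motives.VarietiesProperProofs` does over a field).

## Main results

* `Literature.AlgebraicGeometry.Motives.ProjBaseChangeRing.isPullback_projMap`: for `[CommRing k] [CommRing L] [Algebra k L]
  [Module.Flat k L]`, the square `Proj L[xᵢ] → Proj k[xᵢ]`, `Proj L[xᵢ] → Spec L`,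
  `Proj k[xᵢ] → Spec k`, `Spec L → Spec k` is cartesian (Liu 2002, Prop. 3.1.9 / Ex. 3.1.10).
* `Literature.ProjBaseChangeRing.projToSpec ι R`: the structure morphism `Proj R[xᵢ] → Spec R`; for a
  field it is definitionally the structure morphism of `Literature.AlgebraicGeometry.Motives.projectiveSpace`.
* `Literature.AlgebraicGeometry.Motives.ProjBaseChangeRing.isProper_projToSpec`: `ℙ(ι)_R → Spec R` is proper for `ι` finite
  (Hartshorne II Thm. 4.9; Stacks 01WC).

## Design notes

Everything is copied from `BaseChangeProofs` with `[Field k] [Field L]` replaced by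
`[CommRing k] [CommRing L]` (plus `[Module.Flat k L]` where injectivity of `ψ` is used); the
auxiliary algebra structures are the same local instances (`Literature.AlgebraicGeometry.Motives.ProjBaseChange.algebraBase`,
`algebraLocalizationAway`, `algebraRestrict`). A librarian refactor could make `BaseChangeProofs`
import this file and derive the field case; we do not touch the accepted file here.

## References

* Q. Liu, *Algebraic Geometry and Arithmetic Curves*, Oxford GTM 6 (2002): Prop. 3.1.9 and its
  proof, Example 3.1.10. [Liu2002]
* R. Hartshorne, *Algebraic Geometry*, GTM 52 (1977): II Thm. 4.9. [Hartshorne1977]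
* The Stacks project, Tags 01WC (projective ⇒ proper), 01WF (base change of projective
  morphisms). [StacksProject]
-/
universe u v

open CategoryTheory AlgebraicGeometry Limits TensorProduct HomogeneousLocalization

noncomputable section

namespace Literature.AlgebraicGeometry.Motives

namespace ProjBaseChangeRing

open ProjBaseChange (algebraBase val_algebraMap algebraMap_eq' isScalarTower_localization)

/-! ### Base change of polynomial rings and of their homogeneous localizations (ring version) -/

section MvPoly

open MvPolynomial

attribute [local instance] MvPolynomial.gradedAlgebra MvPolynomial.algebraMvPolynomial
  Literature.AlgebraicGeometry.Motives.ProjBaseChange.algebraBase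

variable (k L : Type u) [CommRing k] [CommRing L] [Algebra k L] (ι : Type v)

/-- `MvPolynomial.map (algebraMap k L) : k[xᵢ] → L[xᵢ]` as a graded ring homomorphism for the
gradings by total degree, for an arbitrary algebra `k → L` of commutative rings (it preserves
homogeneity: Mathlib `IsHomogeneous.map`). [folklore] -/
def mapGraded : homogeneousSubmodule ι k →+*ᵍ homogeneousSubmodule ι L where
  __ := MvPolynomial.map (algebraMap k L)
  map_mem hx := hx.map _

/-- `mapGraded` is `MvPolynomial.map (algebraMap k L)` on elements (`rfl`). [folklore] -/
theorem mapGraded_apply (p : MvPolynomial ι k) :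
    mapGraded k L ι p = MvPolynomial.map (algebraMap k L) p := rfl

/-- `mapGraded` fixes the monic monomials `xᵐ`. [folklore] -/
theorem mapGraded_monomial_one (m : ι →₀ ℕ) :
    mapGraded k L ι (monomial m 1) = monomial m 1 := by
  simp [mapGraded_apply, map_monomial]

open HomogeneousIdeal in
/-- The irrelevant ideal of `L[xᵢ]` is generated by the image of that of `k[xᵢ]` (both are
generated by the variables); the hypothesis of Mathlib's `Proj.map`
(Liu 2002, Prop. 3.1.9, proof: `φ(B₊)E = E₊`). [cite: Liu2002, Prop. 3.1.9 (proof)] -/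
theorem irrelevant_le_map :
    (homogeneousSubmodule ι L)₊ ≤ ((homogeneousSubmodule ι k)₊).map (mapGraded k L ι) := by
  rw [← toIdeal_le_toIdeal_iff, irrelevant_eq_span, Ideal.span_le, toIdeal_map]
  intro x hx
  simp only [Set.mem_iUnion, SetLike.mem_coe, exists_prop] at hx
  obtain ⟨i, hi, hx⟩ := hx
  rw [SetLike.mem_coe, MvPolynomial.as_sum x]
  refine Ideal.sum_mem _ fun m hm ↦ ?_
  have hmon : monomial m (coeff m x) = C (coeff m x) * mapGraded k L ι (monomial m 1) := by
    rw [mapGraded_monomial_one, C_mul_monomial, mul_one]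
  rw [hmon]
  refine Ideal.mul_mem_left _ _ (Ideal.mem_map_of_mem _ ?_)
  exact mem_irrelevant_of_mem _ hi
    (isHomogeneous_monomial (R := k) 1 (Literature.AlgebraicGeometry.Motives.ProjBaseChange.degree_eq_of_mem_support ι hx hm))

variable {ι} (s : MvPolynomial ι k)

variable {s} in
/-- On `Aₛ`, the base-change map of homogeneous localizations (Mathlib
`HomogeneousLocalization.Away.map`) is the base-change map of localizations
`k[xᵢ][1/s] → L[xᵢ][1/s]` (Mathlib `Localization.awayMap`). [folklore] -/
theorem val_awayMap (a : Away (homogeneousSubmodule ι k) s) :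
    (Away.map (mapGraded k L ι) s a).val =
      Localization.awayMap (mapGraded k L ι : MvPolynomial ι k →+* MvPolynomial ι L) s a.val := by
  obtain ⟨c, rfl⟩ := mk_surjective a
  rw [Away.map, map_mk, val_mk, val_mk, Localization.mk_eq_mk', Localization.mk_eq_mk',
    Localization.awayMap, IsLocalization.Away.map, IsLocalization.map_mk']
  rfl

/-- `L[xᵢ][1/s]` as an algebra over `k[xᵢ][1/s]` (through Mathlib `Localization.awayMap`);
an auxiliary local instance. [folklore] -/
@[reducible]
def algebraLocalizationAway : Algebra (Localization.Away s)
    (Localization.Away ((mapGraded k L ι : MvPolynomial ι k →+* MvPolynomial ι L) s)) :=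
  (Localization.awayMap (mapGraded k L ι : MvPolynomial ι k →+* MvPolynomial ι L) s).toAlgebra

attribute [local instance] algebraLocalizationAway

/-- `k[xᵢ] → k[xᵢ][1/s] → L[xᵢ][1/s]` is `k[xᵢ] → L[xᵢ] → L[xᵢ][1/s]`
(Mathlib `IsLocalization.map_eq`). [folklore] -/
theorem algebraMap_localizationAway (p : MvPolynomial ι k) :
    algebraMap (MvPolynomial ι k)
        (Localization.Away ((mapGraded k L ι : MvPolynomial ι k →+* MvPolynomial ι L) s)) p =
      algebraMap (Localization.Away s) _ (algebraMap (MvPolynomial ι k) (Localization.Away s) p) := by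
  rw [RingHom.algebraMap_toAlgebra, Localization.awayMap, IsLocalization.Away.map,
    IsLocalization.map_eq, IsScalarTower.algebraMap_apply (MvPolynomial ι k) (MvPolynomial ι L)
      (Localization.Away ((mapGraded k L ι : MvPolynomial ι k →+* MvPolynomial ι L) s))]
  rfl

/-- `k[xᵢ] → k[xᵢ][1/s] → L[xᵢ][1/s]` is a scalar tower. [folklore] -/
theorem isScalarTower_localizationAway :
    IsScalarTower (MvPolynomial ι k) (Localization.Away s)
      (Localization.Away ((mapGraded k L ι : MvPolynomial ι k →+* MvPolynomial ι L) s)) :=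
  IsScalarTower.of_algebraMap_eq (algebraMap_localizationAway k L s)

/-- `k → k[xᵢ][1/s] → L[xᵢ][1/s]` is a scalar tower. [folklore] -/
theorem isScalarTower_localizationAway' :
    IsScalarTower k (Localization.Away s)
      (Localization.Away ((mapGraded k L ι : MvPolynomial ι k →+* MvPolynomial ι L) s)) := by
  refine IsScalarTower.of_algebraMap_eq fun r ↦ ?_
  rw [IsScalarTower.algebraMap_apply k (MvPolynomial ι k) (Localization.Away s),
    ← algebraMap_localizationAway, ← IsScalarTower.algebraMap_apply]

attribute [local instance] isScalarTower_localizationAway isScalarTower_localizationAway'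

/-- `k[xᵢ][1/s] ⊗ₖ L = L[xᵢ][1/s]`: localization commutes with base change (Mathlib
`Algebra.isPushout_of_isLocalization`) and `k[xᵢ] ⊗ₖ L = L[xᵢ]` (Mathlib), composed
(Liu 2002, proof of Prop. 3.1.9: `B_f ⊗_A C ≃ E_{φ(f)}`). [cite: Liu2002, Prop. 3.1.9 (proof)] -/
theorem isPushout_localizationAway :
    Algebra.IsPushout k (Localization.Away s) L
      (Localization.Away ((mapGraded k L ι : MvPolynomial ι k →+* MvPolynomial ι L) s)) := by
  set B' := Localization.Away ((mapGraded k L ι : MvPolynomial ι k →+* MvPolynomial ι L) s)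
  haveI : IsLocalization (Algebra.algebraMapSubmonoid (MvPolynomial ι L) (.powers s)) B' := by
    rw [Algebra.algebraMapSubmonoid_powers, MvPolynomial.algebraMap_def]
    exact Localization.isLocalization
  have h1 : Algebra.IsPushout (MvPolynomial ι k) (MvPolynomial ι L) (Localization.Away s) B' :=
    Algebra.isPushout_of_isLocalization (.powers s) (Localization.Away s) (MvPolynomial ι L) B'
  exact (Algebra.IsPushout.comp_iff (T := Localization.Away s) (S' := MvPolynomial ι L)
    (T' := B') k (MvPolynomial ι k) L).mpr h1.symm

/-- `L[xᵢ]⁰_(t)` as a `k`-algebra, by restriction of scalars along `k → L`. A plain definition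
(used through `letI`), not an instance. [folklore] -/
@[reducible]
def algebraRestrict (t : MvPolynomial ι L) : Algebra k (Away (homogeneousSubmodule ι L) t) :=
  ((algebraMap L (Away (homogeneousSubmodule ι L) t)).comp (algebraMap k L)).toAlgebra

/-- `k → L → L[xᵢ]⁰_(t)` is a scalar tower for `algebraRestrict` (by construction). [folklore] -/
theorem isScalarTower_algebraRestrict (t : MvPolynomial ι L) :
    letI := algebraRestrict k L t
    IsScalarTower k L (Away (homogeneousSubmodule ι L) t) :=
  letI := algebraRestrict k L t
  IsScalarTower.of_algebraMap_eq (R := k) (S := L) (A := Away (homogeneousSubmodule ι L) t)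
    fun _ ↦ rfl

variable [Algebra k (Away (homogeneousSubmodule ι L) (mapGraded k L ι s))]
  [IsScalarTower k L (Away (homogeneousSubmodule ι L) (mapGraded k L ι s))]

/-- The base-change map `k[xᵢ]⁰_(s) → L[xᵢ]⁰_(s)` on homogeneous localizations (Mathlib
`HomogeneousLocalization.Away.map`) is a `k`-algebra homomorphism
(Liu 2002, proof of Prop. 3.1.9). [cite: Liu2002, Prop. 3.1.9 (proof)] -/
def awayMapₐ : Away (homogeneousSubmodule ι k) s →ₐ[k]
    Away (homogeneousSubmodule ι L) (mapGraded k L ι s) where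
  __ := Away.map (mapGraded k L ι) s
  commutes' r := by
    apply val_injective
    change (Away.map (mapGraded k L ι) s (algebraMap k _ r)).val = _
    rw [IsScalarTower.algebraMap_apply k L (Away (homogeneousSubmodule ι L) (mapGraded k L ι s)),
      val_algebraMap, algebraMap_eq', Away.map, map_mk, val_mk]
    simp only [SetLike.GradeZero.coe_algebraMap, MvPolynomial.algebraMap_eq]
    rw [IsScalarTower.algebraMap_apply L (MvPolynomial ι L) (Localization _),
      ← Localization.mk_algebraMap]
    congr 1
    · simp [mapGraded_apply, map_C]
    · ext; simp

/-- `awayMapₐ` is `Away.map` on elements (`rfl`). [folklore] -/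
@[simp]
theorem awayMapₐ_apply (a : Away (homogeneousSubmodule ι k) s) :
    awayMapₐ k L s a = Away.map (mapGraded k L ι) s a := rfl

/-- The comparison map `ψ : k[xᵢ]⁰_(s) ⊗ₖ L → L[xᵢ]⁰_(s)`, `(a/sⁿ) ⊗ c ↦ c·a/sⁿ`
(Liu 2002, proof of Prop. 3.1.9). [cite: Liu2002, Prop. 3.1.9 (proof)] -/
def tensorToAway : Away (homogeneousSubmodule ι k) s ⊗[k] L →ₐ[k]
    Away (homogeneousSubmodule ι L) (mapGraded k L ι s) :=
  Algebra.TensorProduct.lift (awayMapₐ k L s) (IsScalarTower.toAlgHom k L _) fun _ _ ↦ .all _ _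

/-- `ψ ((a/sⁿ) ⊗ c) = φ(a)/φ(s)ⁿ · c`. [cite: Liu2002, Prop. 3.1.9 (proof)] -/
@[simp]
theorem tensorToAway_tmul (a : Away (homogeneousSubmodule ι k) s) (c : L) :
    tensorToAway k L s (a ⊗ₜ c) = Away.map (mapGraded k L ι) s a * algebraMap L _ c :=
  Algebra.TensorProduct.lift_tmul ..

variable {s} in
/-- `ψ` is surjective: a homogeneous `a ∈ L[xᵢ]` of degree `n·deg s` is an `L`-linear combination
of monomials, which come from `k[xᵢ]` (Liu 2002, proof of Prop. 3.1.9). [cite: Liu2002, Prop. 3.1.9 (proof)] -/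
theorem tensorToAway_surjective {d : ℕ} (hs : s ∈ homogeneousSubmodule ι k d) :
    Function.Surjective (tensorToAway k L s) := by
  intro z
  have hFs : mapGraded k L ι s ∈ homogeneousSubmodule ι L d := (mapGraded k L ι).map_mem hs
  obtain ⟨n, a, ha, rfl⟩ := Away.mk_surjective (homogeneousSubmodule ι L) hFs z
  set S : Set (MvPolynomial ι L) := {p | ∃ m : ι →₀ ℕ, m.degree = n • d ∧ p = monomial m 1}
  have hS : Submodule.span L S ≤ homogeneousSubmodule ι L (n • d) := by
    refine Submodule.span_le.mpr ?_
    rintro _ ⟨m, hm, rfl⟩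
    exact isHomogeneous_monomial 1 hm
  have haS : a ∈ Submodule.span L S := by
    rw [MvPolynomial.as_sum a]
    refine Submodule.sum_mem _ fun m hm ↦ ?_
    rw [← mul_one (coeff m a), ← smul_eq_mul, ← smul_monomial]
    exact Submodule.smul_mem _ _
      (Submodule.subset_span ⟨m, Literature.AlgebraicGeometry.Motives.ProjBaseChange.degree_eq_of_mem_support ι ha hm, rfl⟩)
  suffices h : ∀ p (hp : p ∈ Submodule.span L S),
      Away.mk _ hFs n p (hS hp) ∈ (tensorToAway k L s).range by
    obtain ⟨y, hy⟩ := h a haS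
    exact ⟨y, hy⟩
  intro p hp
  induction hp using Submodule.span_induction with
  | mem p hp =>
    obtain ⟨m, hm, rfl⟩ := hp
    refine ⟨Away.mk _ hs n (monomial m 1) (isHomogeneous_monomial 1 hm) ⊗ₜ 1, ?_⟩
    change tensorToAway k L s _ = _
    rw [tensorToAway_tmul, Away.map_mk]
    apply val_injective
    rw [val_mul, val_algebraMap, (algebraMap L _).map_one, mul_one, Away.val_mk, Away.val_mk]
    congr 1
    exact mapGraded_monomial_one k L ι m
  | zero =>
    have h0 : Away.mk _ hFs n (0 : MvPolynomial ι L) (zero_mem _) = 0 := by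
      apply val_injective
      rw [Away.val_mk, val_zero, Localization.mk_zero]
    rw [h0]
    exact zero_mem _
  | add p q hp hq ihp ihq =>
    have hadd : Away.mk _ hFs n (p + q) (hS (add_mem hp hq)) =
        Away.mk _ hFs n p (hS hp) + Away.mk _ hFs n q (hS hq) := by
      apply val_injective
      rw [val_add, Away.val_mk, Away.val_mk, Away.val_mk, Localization.add_mk_self]
    rw [hadd]
    exact add_mem ihp ihq
  | smul c p hp ih =>
    have h1 : algebraMap L (Away (homogeneousSubmodule ι L) (mapGraded k L ι s)) c ∈
        (tensorToAway k L s).range :=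
      ⟨1 ⊗ₜ c, by change tensorToAway k L s _ = _; rw [tensorToAway_tmul, map_one, one_mul]⟩
    have hsmul : Away.mk _ hFs n (c • p) (hS (Submodule.smul_mem _ c hp)) =
        algebraMap L _ c * Away.mk _ hFs n p (hS hp) := by
      apply val_injective
      rw [val_mul, val_algebraMap, Away.val_mk, Away.val_mk, smul_eq_C_mul,
        IsScalarTower.algebraMap_apply L (MvPolynomial ι L) (Localization _),
        MvPolynomial.algebraMap_eq, ← Localization.mk_algebraMap, Localization.mk_mul]
      congr 1
      exact (one_mul _).symm
    rw [hsmul]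
    exact mul_mem h1 ih

attribute [local instance] Literature.AlgebraicGeometry.Motives.ProjBaseChange.isScalarTower_localization

variable {s} in
/-- `ψ` is injective when `L` is flat over `k`: `A⁰_(s) ⊗ₖ L → A_s ⊗ₖ L` is injective (`L` flat and
`A⁰_(s) ⊆ A_s`), `A_s ⊗ₖ L ≃ (A ⊗ₖ L)_s`, and the composite factors through `ψ` followed by the
inclusion `(A ⊗ₖ L)⁰_(s) ⊆ (A ⊗ₖ L)_s` (Liu 2002, proof of Prop. 3.1.9, where `L` is a field
extension; flatness is what the argument uses). [cite: Liu2002, Prop. 3.1.9 (proof)] -/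
theorem tensorToAway_injective [Module.Flat k L] : Function.Injective (tensorToAway k L s) := by
  haveI hP := isPushout_localizationAway k L s
  set B' := Localization.Away ((mapGraded k L ι : MvPolynomial ι k →+* MvPolynomial ι L) s)
  let θ := Algebra.IsPushout.equiv k (Localization.Away s) L B'
  let v : Away (homogeneousSubmodule ι k) s →ₗ[k] Localization.Away s :=
    (IsScalarTower.toAlgHom k (Away (homogeneousSubmodule ι k) s) (Localization.Away s)).toLinearMap
  have hv : ∀ a, v a = a.val := fun a ↦ rfl
  have key : ∀ x, (tensorToAway k L s x).val = θ (v.rTensor L x) := by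
    intro x
    induction x using TensorProduct.induction_on with
    | zero => rw [map_zero, map_zero, map_zero, val_zero]; rfl
    | tmul a c =>
      rw [tensorToAway_tmul, val_mul, val_algebraMap, LinearMap.rTensor_tmul,
        Algebra.IsPushout.equiv_tmul, RingHom.algebraMap_toAlgebra, hv, val_awayMap]
      rfl
    | add x y hx hy => rw [map_add, val_add, hx, hy, map_add, map_add]; rfl
  intro x y hxy
  have h := congr_arg HomogeneousLocalization.val hxy
  rw [key, key] at h
  exact Module.Flat.rTensor_preserves_injective_linearMap (M := L) v
    (fun a b hab ↦ val_injective _ (by rwa [← hv, ← hv])) (θ.injective h)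

variable {s} in
/-- `ψ : k[xᵢ]⁰_(s) ⊗ₖ L ≃ L[xᵢ]⁰_(s)` for `s` homogeneous and `L` flat over `k`
(Liu 2002, Prop. 3.1.9, key step of the proof, for `B = k[x₀,…,x_N]`, `C = L`). [cite: Liu2002, Prop. 3.1.9 (proof)] -/
theorem tensorToAway_bijective [Module.Flat k L] {d : ℕ} (hs : s ∈ homogeneousSubmodule ι k d) :
    Function.Bijective (tensorToAway k L s) :=
  ⟨tensorToAway_injective k L, tensorToAway_surjective k L hs⟩

end MvPoly

/-! ### Projective space over a ring commutes with flat base change -/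

section Proj

open MvPolynomial HomogeneousIdeal

attribute [local instance] MvPolynomial.gradedAlgebra Literature.AlgebraicGeometry.Motives.ProjBaseChange.algebraBase

-- `ι : Type` (universe `0`), so that `Proj k[xᵢ]` and `Spec k` live in the same universe `u`.
variable (k L : Type u) [CommRing k] [CommRing L] [Algebra k L] (ι : Type)

/-- The ring isomorphism `ψ : k[xᵢ]⁰_(s) ⊗ₖ L ≅ L[xᵢ]⁰_(s)` in `CommRingCat` (`L` flat over `k`). [cite: Liu2002, Prop. 3.1.9 (proof)] -/
def tensorAwayIso [Module.Flat k L] {d : ℕ} (s : MvPolynomial ι k)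
    (hs : s ∈ homogeneousSubmodule ι k d) :
    CommRingCat.of (Away (homogeneousSubmodule ι k) s ⊗[k] L) ≅
      CommRingCat.of (Away (homogeneousSubmodule ι L) (mapGraded k L ι s)) :=
  letI := algebraRestrict k L (mapGraded k L ι s)
  haveI := isScalarTower_algebraRestrict k L (mapGraded k L ι s)
  (RingEquiv.ofBijective (tensorToAway k L s).toRingHom
    (tensorToAway_bijective k L hs)).toCommRingCatIso

/-- `k → k[xᵢ]⁰_(s)`, `k → L`, `k[xᵢ]⁰_(s) → L[xᵢ]⁰_(s)`, `L → L[xᵢ]⁰_(s)` is a pushout square of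
commutative rings when `L` is flat over `k`. [cite: Liu2002, Prop. 3.1.9 (proof)] -/
theorem isPushout_away [Module.Flat k L] {d : ℕ} (s : MvPolynomial ι k)
    (hs : s ∈ homogeneousSubmodule ι k d) :
    IsPushout (CommRingCat.ofHom (algebraMap k (Away (homogeneousSubmodule ι k) s)))
      (CommRingCat.ofHom (algebraMap k L))
      (CommRingCat.ofHom (Away.map (mapGraded k L ι) s))
      (CommRingCat.ofHom (algebraMap L (Away (homogeneousSubmodule ι L) (mapGraded k L ι s)))) := by
  letI := algebraRestrict k L (mapGraded k L ι s)
  haveI := isScalarTower_algebraRestrict k L (mapGraded k L ι s)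
  refine (CommRingCat.isPushout_tensorProduct k (Away (homogeneousSubmodule ι k) s) L).of_iso
    (Iso.refl _) (Iso.refl _) (Iso.refl _) (tensorAwayIso k L ι s hs) (by simp) (by simp) ?_ ?_
  · refine CommRingCat.hom_ext (RingHom.ext fun a ↦ ?_)
    change tensorToAway k L s (a ⊗ₜ 1) = Away.map (mapGraded k L ι) s a
    rw [tensorToAway_tmul, map_one, mul_one]
  · refine CommRingCat.hom_ext (RingHom.ext fun c ↦ ?_)
    change tensorToAway k L s (1 ⊗ₜ c) = algebraMap L _ c
    rw [tensorToAway_tmul, map_one, one_mul]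

/-- `D₊(s) ⊆ ℙ_L` is the fibre product `D₊(s) ×_k L` (with `D₊(s) ⊆ ℙ_k`), `L` flat over `k`:
the affine square `Spec` of `isPushout_away`. [cite: Liu2002, Prop. 3.1.9 (proof)] -/
theorem isPullback_Spec_away [Module.Flat k L] {d : ℕ} (s : MvPolynomial ι k)
    (hs : s ∈ homogeneousSubmodule ι k d) :
    IsPullback (Spec.map (CommRingCat.ofHom (Away.map (mapGraded k L ι) s)))
      (Spec.map (CommRingCat.ofHom
        (algebraMap L (Away (homogeneousSubmodule ι L) (mapGraded k L ι s)))))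
      (Spec.map (CommRingCat.ofHom (algebraMap k (Away (homogeneousSubmodule ι k) s))))
      (Spec.map (CommRingCat.ofHom (algebraMap k L))) :=
  isPullback_SpecMap_of_isPushout _ _ _ _ (isPushout_away k L ι s hs)

variable {k L} in
/-- The structure morphism `ℙ(ι)_R = Proj R[xᵢ] → Spec (R[xᵢ])₀ → Spec R` of projective space
over a commutative ring `R` (for a field this is literally the structure morphism of
`Literature.AlgebraicGeometry.Motives.projectiveSpace`, cf. `Literature.AlgebraicGeometry.Motives.ProjBaseChange.projToSpec`). [folklore] -/
abbrev projToSpec (R : Type u) [CommRing R] :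
    Proj (homogeneousSubmodule ι R) ⟶ Spec (.of R) :=
  Proj.toSpecZero (homogeneousSubmodule ι R) ≫
    Spec.map (CommRingCat.ofHom (algebraMap R (homogeneousSubmodule ι R 0)))

variable {k L} in
/-- On the chart `D₊(t) = Spec R[xᵢ]⁰_(t)` the structure morphism to `Spec R` is `Spec` of the
structure map `R → R[xᵢ]⁰_(t)` (Mathlib `Proj.awayι_toSpecZero`). [folklore] -/
theorem awayι_projToSpec {R : Type u} [CommRing R] {t : MvPolynomial ι R} {d : ℕ}
    (ht : t ∈ homogeneousSubmodule ι R d) (hd : 0 < d) :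
    Proj.awayι (homogeneousSubmodule ι R) t ht hd ≫ projToSpec ι R =
      Spec.map (CommRingCat.ofHom (algebraMap R (Away (homogeneousSubmodule ι R) t))) := by
  rw [Proj.awayι_toSpecZero_assoc, ← Spec.map_comp, ← CommRingCat.ofHom_comp]

/-- **`ℙ(ι)_L = ℙ(ι)_k ×_{Spec k} Spec L` for `L` a flat `k`-algebra.** The square formed by `Proj`
of the base-change map `k[xᵢ] → L[xᵢ]` (Mathlib `Proj.map`) and the structure morphisms is
cartesian (Liu 2002, Prop. 3.1.9 `Proj(B ⊗_A C) ≅ Proj B ×_{Spec A} Spec C` with `B = k[xᵢ]`,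
`C = L`, and Example 3.1.10 `(ℙⁿ_A)_C = ℙⁿ_C`; the printed statement has no flatness hypothesis,
our proof of the chartwise isomorphism uses it). [cite: Liu2002, Prop. 3.1.9 and Ex. 3.1.10] -/
theorem isPullback_projMap [Module.Flat k L] :
    IsPullback (Proj.map (mapGraded k L ι) (irrelevant_le_map k L ι)) (projToSpec ι L)
      (projToSpec ι k) (Spec.map (CommRingCat.ofHom (algebraMap k L))) := by
  refine Scheme.isPullback_of_openCover _ _ _ _
    (Proj.affineOpenCover (homogeneousSubmodule ι k)).openCover fun i ↦ ?_
  have hd : 0 < (i.1 : ℕ) := i.1.2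
  have hs : (i.2 : MvPolynomial ι k) ∈ homogeneousSubmodule ι k i.1 := i.2.2
  have hopen : IsPullback
      (Spec.map (CommRingCat.ofHom (Away.map (mapGraded k L ι) (i.2 : MvPolynomial ι k))))
      (Proj.awayι (homogeneousSubmodule ι L) (mapGraded k L ι (i.2 : MvPolynomial ι k))
        ((mapGraded k L ι).map_mem hs) hd)
      (Proj.awayι (homogeneousSubmodule ι k) (i.2 : MvPolynomial ι k) hs hd)
      (Proj.map (mapGraded k L ι) (irrelevant_le_map k L ι)) :=
    IsOpenImmersion.isPullback _ _ _ _ (Proj.awayι_comp_map _ _ hd _ hs)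
      (by rw [Proj.opensRange_awayι, Proj.opensRange_awayι, Proj.map_preimage_basicOpen])
  have hSpec := isPullback_Spec_away k L ι (i.2 : MvPolynomial ι k) hs
  refine hSpec.of_iso hopen.flip.isoPullback (Iso.refl _) (Iso.refl _) (Iso.refl _) ?_ ?_ ?_ ?_
  · exact (Category.comp_id _).trans hopen.flip.isoPullback_hom_snd.symm
  · exact (Category.comp_id _).trans
      ((awayι_projToSpec ι ((mapGraded k L ι).map_mem hs) hd).symm.trans
        ((congrArg (· ≫ projToSpec ι L) hopen.flip.isoPullback_hom_fst.symm).trans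
          (Category.assoc _ _ _)))
  · exact (Category.comp_id _).trans
      ((awayι_projToSpec ι hs hd).symm.trans (Category.id_comp _).symm)
  · simp

/-! ### Properness of projective space over a ring -/

variable (R : Type u) [CommRing R]

/-- `R[x₀, …, xₙ]` is of finite type over its degree-zero part `R[x₀, …, xₙ]₀` when there are
finitely many variables (it is already of finite type over `R ⊆ R[x₀, …, xₙ]₀`); this is the
hypothesis of Mathlib's properness of `Proj.toSpecZero`. [folklore] -/
theorem finiteType_gradeZero_mvPolynomial [Finite ι] :
    Algebra.FiniteType (homogeneousSubmodule ι R 0) (MvPolynomial ι R) := by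
  haveI : IsScalarTower R (homogeneousSubmodule ι R 0) (MvPolynomial ι R) :=
    IsScalarTower.of_algebraMap_eq (R := R) (S := homogeneousSubmodule ι R 0)
      (A := MvPolynomial ι R) (fun _ => rfl)
  exact Algebra.FiniteType.of_restrictScalars_finiteType R _ _

/-- The degree-zero part of `R[xᵢ]` is `R`: `R → R[xᵢ]₀` is bijective (a polynomial
homogeneous of degree `0` is a constant). [folklore] -/
theorem bijective_algebraMap_gradeZero_mvPolynomial :
    Function.Bijective (algebraMap R (homogeneousSubmodule ι R 0)) := by
  constructor
  · intro a b h
    have := congrArg Subtype.val h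
    simpa using this
  · rintro ⟨p, hp⟩
    rw [MvPolynomial.mem_homogeneousSubmodule, ← MvPolynomial.totalDegree_zero_iff_isHomogeneous,
      MvPolynomial.totalDegree_eq_zero_iff_eq_C] at hp
    refine ⟨MvPolynomial.coeff 0 p, Subtype.ext ?_⟩
    rw [SetLike.GradeZero.coe_algebraMap, MvPolynomial.algebraMap_eq]
    exact hp.symm

/-- `Spec R[xᵢ]₀ → Spec R` is an isomorphism (`Spec` of a bijective ring map). [folklore] -/
theorem isIso_specMap_gradeZero_mvPolynomial :
    IsIso (Spec.map (CommRingCat.ofHom (algebraMap R (homogeneousSubmodule ι R 0)))) := by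
  haveI : IsIso (CommRingCat.ofHom (algebraMap R (homogeneousSubmodule ι R 0))) :=
    (RingEquiv.ofBijective _
      (bijective_algebraMap_gradeZero_mvPolynomial ι R)).toCommRingCatIso.isIso_hom
  infer_instance

/-- **Projective space is proper over any base ring**: `ℙ(ι)_R → Spec R` (finitely many
variables) is proper, as `Proj R[xᵢ] → Spec R[xᵢ]₀` is proper (Mathlib, valuative criterion) and
`Spec R[xᵢ]₀ → Spec R` is an isomorphism (Hartshorne II Thm. 4.9 reduction; Stacks 01WC).
[cite: Hartshorne1977, Ch. II Thm. 4.9 (p. 103)] -/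
theorem isProper_projToSpec [Finite ι] : IsProper (projToSpec ι R) := by
  haveI := finiteType_gradeZero_mvPolynomial ι R
  haveI := isIso_specMap_gradeZero_mvPolynomial ι R
  change IsProper (Proj.toSpecZero (homogeneousSubmodule ι R) ≫
    Spec.map (CommRingCat.ofHom (algebraMap R (homogeneousSubmodule ι R 0))))
  infer_instance

end Proj

end ProjBaseChangeRing

end Literature.AlgebraicGeometry.Motives

end
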